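import Summits.QuantumFields.YangMills.Theorems.BalabanUVNodesN15PerCubeGreenTwoGridEntryThreeKnit
import Summits.QuantumFields.YangMills.Theorems.BalabanUVNodesN15PerCubeGreenTwoGridSummandDefect
import Summits.QuantumFields.YangMills.Theorems.BalabanUVNodesN15PerCubeGreenTwoGridKnitDefect
import Summits.QuantumFields.YangMills.Theorems.BalabanUVNodesN15PerCubeGreenCovariant
import Summits.QuantumFields.YangMills.Theorems.BalabanUVNodesN15PerCubeGreenFineCovariant
import HarnessLib

/-!
# N15 = NE2, road (c) — PROGRAMME (PC), ENTRY 3 OF (3.42) (`Δ_{R_U}G′`) AT TWO SPACINGS WITHOUT JETS, WITH BAŁABAN's SUMMAND `P = a·Q′_TᵀQ′_T` LIVE: n15-c∕380 instantiated exactly as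
# n15-c∕340 instantiates n15-c∕339 (every one-grid row of `P`, `N_V` produced from the POINTWISE (3.35) letters in the cube gauges), its two displayed rows of the summand DISCHARGED by
# n15-c∕377 (`P′ ≤ a₀|ι|²e^{−δd}`) and n15-c∕379 (`𝔇_{τ_S}(P′,P)` from the cube-gauge letters on the plateau blocks) — what stays displayed is 340's pairing data plus the pairing itself
# (`U = straight fine holonomies of U′`) and the all-direction step letter `b` on the plateau blocks (dag-n15-c g34, n15-c∕381)

Cell `pub-ymgap`, seat `pub-ymgap-dag-n15-c` (generation g34; R134 (a) seat, strategy s1 «first missing estimate»; HUMAN RULING D-0062; chair R424 venue).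
`bears_on: R4∕N15 · K3⁸ SpineGivenEndpointR13SepCoPHV (stmt-QuantumFields-27366)`; filed `--kind proof --supports stmt-QuantumFields-27366 --as helper` — COUNT-NEUTRAL.
ONE theorem, 0 `def`, 0 `sorry`.  Imports BY NAME n15-c∕380 `…EntryThreeKnit` (`uN_idef_entryThree_tr`), n15-c∕379 `…SummandDefect` (`hasMaj_idef_ctauS_scP`), n15-c∕377 (`hasMaj_scP'_of_unitary`, through 379),
and everything n15-c∕340 imports (its dischargers: `scP_conj`, `scP'_conj`, `hasMaj_scNV(')_cut_of_rows`, `one_sub_scPsi(')_comp_scNV(')_comp_scChi(')`, `mulOp_one_sub_scPsi_comp_csavgGram_comp_mulOp_scH`,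
dag-n15-w2's entry letters, `chiCube_box_eq_one_of_coverH_ne_zero`).  The statement and proof are n15-c∕340's, transformed by HOME `tools/g34/build_H14.py` (H := 380; the cut algebra
`M_χM_h = M_h` on both grids by `mulOp_comp_mulOp_of_support_left` + `chiCube_box_eq_one_of_coverH_ne_zero`).  Nothing in the tree is modified, no landed name re-declared.

THE THEOREM `uN_idef_scGreen_entryThree_tr`: for odd `L ≥ 7`, `a₀ > 0`, a colour index `ι` there are `δ, w₀, R₀, ρ₀ > 0`, `D, B, c ≥ 0` such that on every doubled torus of the cover
(`k ≥ 1`, `L^m ≥ w₀`, `r ≥ 1`), for trace-form coordinates, unitary fine cube gauges `u′_k`, unitary `U`, `U′` WITH `U` = the straight fine holonomies of `U′` (King's pairing), site sets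
`Qf ⊇` (cut boxes ∪ plateau blocks), `Qc`, the pointwise (3.35) letters `p, q` of the cube-gauged fields on them (fine, and coarse in the induced gauge), thresholds `r_V, o_V, o_N, o`, the
three two-grid fits `hfitC hfitA hDNV` of the pairing, and the all-direction step letter `b` of the cube-gauged fine field on the plateau blocks:
`𝔇_{τ_S}(Δ_{R_U′}∘G′(U′), Δ_{R_U}∘G′(U)) ≤ (a₀|ι|²·D·((L^k)^{−1∕4} + o + s)·c + o_P·B·c)·e^{−ρ₀|y−y′|_T}` blockwise, `s` the smeared stair letter of `p`, `o_P = |K|·(a₀|ι|³o_h + |ι|²(m + 2s′a₀|ι|²))`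
n15-c∕379's constant at `ρ = η′p`.

HONEST FRAMING ∕ LIMITS.  Bookkeeping (n15-c∕340's, verbatim, plus two rows): MODEL carriers (King tori, one cube scale), the SHAPE of [B9] Thm 3.14 ∕ (3.42) entry 3 for the scalar
`G′(U)`, NOT the printed theorem; the displayed pairing data are produced from ONE (3.35) datum per cube by n15-c∕344's producers (`sc_hfitC_of_pairing`, `sc_hfitA_of_pairing`,
`hasMaj_idef_scNV_pairing`, n15-c∕346's gauge) — that last instantiation (the entry-3 twin of n15-c∕344∕353∕374, rate in `η`) is NOT in this file.  Entries 1–2 of (3.42) need the jet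
editions — NOT here.  NE2⁺ NOT PRINTED ∕ NOT proved; N15 of record untouched (DISCHARGED AS CONSUMED, p687738); K3⁸ OPEN; counts of record UNMOVED (typed 28∕28 · discharged 8∕27); one finite
𝕋⁴ at fixed ε per index — NOT infinite volume, NOT OS on ℝ⁴, NOT a mass gap, NOT Clay.  Restate-immune (no Theses import).
-/


noncomputable section

open scoped BigOperators Matrix Matrix.Norms.L2Operator

namespace Summit.QuantumFields.YangMills.BalabanUVNodes.N15.Gluing

open Real
open Literature.MathematicalPhysics.QuantumFieldTheory.Balaban1983to89
open Literature.MathematicalPhysics.QuantumFieldTheory.Balaban1983to89.B5Prop11Plancherel (Tor fine unitVec)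
open Literature.MathematicalPhysics.QuantumFieldTheory.Balaban1983to89.B11SectG (BlockNorm HasMaj hasMaj_zero)
open Literature.MathematicalPhysics.QuantumFieldTheory.Balaban1983to89.T4EtaRateDefect (idef idef_zero)
open Literature.MathematicalPhysics.QuantumFieldTheory.Balaban1983to89.T4EtaRateCoeffDefect (pull)
open Literature.MathematicalPhysics.QuantumFieldTheory.Balaban1983to89.B6Prop26Gluing (mulOp mulOp_apply ind ind_nonneg)
open Literature.MathematicalPhysics.QuantumFieldTheory.Balaban1983to89.B6UnitTorusCarrier (unitTorusGeo unitTorusGeo_dist_nonneg)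
open Literature.MathematicalPhysics.QuantumFieldTheory.Balaban1983to89.B5SiteBridgeP12 (MP)
open Literature.MathematicalPhysics.QuantumFieldTheory.King1986 (aK aK_pos aK_le)
open Literature.MathematicalPhysics.QuantumFieldTheory.King1986.Torus (blockOf)
open Literature.Barriers.QuantumFields (traceForm)
open Summit.QuantumFields.YangMills.BalabanUVNodes.N15.BackgroundLayer (covLapM tCoefA tCoefC)
open Summit.QuantumFields.YangMills.BalabanUVNodes.N15.VectorPiece (kingPr)
open Summit.QuantumFields.YangMills.BalabanUVNodes.N15.MatrixSpecies (mmulOp coordMat basisConst basisConst_nonneg liftBlk liftMap liftEquiv)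
open Summit.QuantumFields.YangMills.BalabanUVNodes.N15.TwoGrid (chiCube cubeBlocks)
open Summit.QuantumFields.YangMills.BalabanUVNodes.N15.CurvedSpecies (gaugePair rowSum_tCoefA_inl_le_at rowSum_tCoefA_inr_le_at rowSum_tCoefC_le_at uN_abs_coordMat_conj_sub_one_entry_le_op
  uN_abs_coordMat_conj_sub_conj_entry_le_op uN_coordMat_conj_orthogonal uN_gaugeTransformed_bond_unitary)
open Summit.QuantumFields.YangMills.BalabanUVNodes.N15.CovLandau (csavg)
open Summit.QuantumFields.YangMills.BalabanUVNodes.N15.CovAvg (kingSec ctauS mprod blockOf_kingPr)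

variable {d : ℕ}

section Green

variable {L : ℕ} [NeZero L]

set_option maxHeartbeats 1600000 in
/-- ★★★ **ENTRY 3 OF (3.42) AT TWO SPACINGS WITHOUT JETS, BAŁABAN's SUMMAND LIVE** — see the module docstring: n15-c∕340's displayed data + the pairing + the step letter `b` on the
plateau blocks ⟹ `𝔇_{τ_S}(Δ_{R_U′}∘scGlued′, Δ_{R_U}∘scGlued) ≤ (a₀|ι|²·D·X·c + o_P·B·c)·e^{−ρ₀|y−y′|_T}`.  MODEL carriers; the SHAPE of [B9] Thm 3.14 ∕ (3.42) entry 3, NOT the printed theorem.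
[cite: Balaban1985BackgroundPropagators, Thm 3.14 pp.426–427, (3.42) p.397, (3.19) p.393, (3.24) p.394, (3.34)–(3.35) p.396, (3.62)–(3.65) pp.402–403 (shapes ∕ mechanism); Balaban1984PropagatorsII,
(2.36)–(2.37) p.229, (2.133)–(2.136) p.247; King1986, p.664 (pairing)] -/
theorem uN_idef_scGreen_entryThree_tr (hL : Odd L ∧ 1 < L) (hL7 : 7 ≤ L) {a₀ : ℝ} (ha₀ : 0 < a₀) (ι : Type) [Fintype ι] [DecidableEq ι] :
    ∃ δ w₀ R₀ D B c ρ₀ : ℝ, 0 < δ ∧ 0 < R₀ ∧ 0 < ρ₀ ∧ 0 ≤ D ∧ 0 ≤ B ∧ 0 ≤ c ∧ ∀ (mv kk r : ℕ), 1 ≤ kk → 1 ≤ r → w₀ ≤ ((L ^ mv : ℕ) : ℝ) →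
      ∀ {mm : Type} [Fintype mm] [DecidableEq mm] [Nonempty mm] (e : Matrix mm mm ℂ ≃L[ℝ] (ι → ℝ)), (∀ A B : Matrix mm mm ℂ, traceForm A B = e A ⬝ᵥ e B) →
      ∀ (u' : (Fin (d + 1) → ZMod (2 * L)) → ScX' d L mv kk r hL → Matrix mm mm ℂ), (∀ k x', (u' k x')ᴴ * u' k x' = 1) →
      ∀ (U : Fin (d + 1) → ScX d L mv kk hL → Matrix mm mm ℂ), (∀ μ x, (U μ x)ᴴ * U μ x = 1) → ∀ (U' : Fin (d + 1) → ScX' d L mv kk r hL → Matrix mm mm ℂ), (∀ μ x', (U' μ x')ᴴ * U' μ x' = 1) →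
      ∀ (Qf : (Fin (d + 1) → ZMod (2 * L)) → Set (ScX' d L mv kk r hL)) (Qc : (Fin (d + 1) → ZMod (2 * L)) → Set (ScX d L mv kk hL)) (p q : ℝ), 0 ≤ p → 0 ≤ q →
        (∀ k x', scChi' d L mv kk r hL k x' ≠ 0 → x' ∈ Qf k ∧ ∀ μ, (scShift' d L mv kk r hL μ).symm x' ∈ Qf k) → (∀ k y', scBlk' d L mv kk r hL y' ∈ cvSk d L mv kk hL k → y' ∈ Qf k) →
        (∀ k x, scChi d L mv kk hL k x ≠ 0 → x ∈ Qc k ∧ ∀ μ, (scShift d L mv kk hL μ).symm x ∈ Qc k) →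
        -- the POINTWISE (3.35) letters of the transformed bond variables: fine, in the cube gauge `u′_k`, on `Qf k`
        (∀ k μ z, z ∈ Qf k → ‖(u' k z * U' μ z * (u' k (scShift' d L mv kk r hL μ z))ᴴ) - 1‖ ≤ ((((L ^ r * L ^ kk : ℕ) : ℝ))⁻¹) * p) →
        (∀ k μ z, z ∈ Qf k → ‖(u' k z * U' μ z * (u' k (scShift' d L mv kk r hL μ z))ᴴ) - (u' k ((scShift' d L mv kk r hL μ).symm z) * U' μ ((scShift' d L mv kk r hL μ).symm z) * (u' k (scShift' d L mv kk r hL μ ((scShift' d L mv kk r hL μ).symm z)))ᴴ)‖ ≤ ((((L ^ r * L ^ kk : ℕ) : ℝ))⁻¹) ^ 2 * q) →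
        -- … and coarse, in the INDUCED gauge `u′_k∘σ`, on `Qc k` (the covariant fit of the PAIRING, displayed)
        (∀ k μ x, x ∈ Qc k → ‖(u' k (kingSec (cvM d L mv kk hL) L kk r x) * U μ x * (u' k (kingSec (cvM d L mv kk hL) L kk r (scShift d L mv kk hL μ x)))ᴴ) - 1‖ ≤ ((((L ^ kk : ℕ) : ℝ))⁻¹) * p) →
        (∀ k μ x, x ∈ Qc k → ‖(u' k (kingSec (cvM d L mv kk hL) L kk r x) * U μ x * (u' k (kingSec (cvM d L mv kk hL) L kk r (scShift d L mv kk hL μ x)))ᴴ) - (u' k (kingSec (cvM d L mv kk hL) L kk r ((scShift d L mv kk hL μ).symm x)) * U μ ((scShift d L mv kk hL μ).symm x) * (u' k (kingSec (cvM d L mv kk hL) L kk r (scShift d L mv kk hL μ ((scShift d L mv kk hL μ).symm x))))ᴴ)‖ ≤ ((((L ^ kk : ℕ) : ℝ))⁻¹) ^ 2 * q) →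
      ∀ (rV oV oN o : ℝ), 0 ≤ rV → 0 ≤ oV → 0 ≤ oN →
        Fintype.card ι * (@basisConst ι _ (Matrix mm mm ℂ) Matrix.frobeniusNormedAddCommGroup Matrix.frobeniusNormedSpace e * (2 * Real.sqrt (Fintype.card mm)) * (Real.sqrt (Fintype.card mm) * p)) ≤ rV → Fintype.card ι * (Fintype.card (Fin (d + 1)) * (Fintype.card ι * (@basisConst ι _ (Matrix mm mm ℂ) Matrix.frobeniusNormedAddCommGroup Matrix.frobeniusNormedSpace e * (2 * Real.sqrt (Fintype.card mm)) * (Real.sqrt (Fintype.card mm) * p)) ^ 2 + (@basisConst ι _ (Matrix mm mm ℂ) Matrix.frobeniusNormedAddCommGroup Matrix.frobeniusNormedSpace e * (2 * Real.sqrt (Fintype.card mm)) * (Real.sqrt (Fintype.card mm) * q)))) ≤ rV →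
        rV * (1 + Fintype.card (Fin (d + 1) ⊕ Fin (d + 1))) + (a₀ * (Fintype.card ι * (Fintype.card ι * ((1 + rV * ((((L ^ kk : ℕ) : ℝ))⁻¹)) ^ ((d + 1) * L ^ kk) - 1) ^ 2 + 2 * ((1 + rV * ((((L ^ kk : ℕ) : ℝ))⁻¹)) ^ ((d + 1) * L ^ kk) - 1))) + a₀ * (Fintype.card ι * (Fintype.card ι * ((1 + rV * ((((L ^ r * L ^ kk : ℕ) : ℝ))⁻¹)) ^ ((d + 1) * (L ^ r * L ^ kk)) - 1) ^ 2 + 2 * ((1 + rV * ((((L ^ r * L ^ kk : ℕ) : ℝ))⁻¹)) ^ ((d + 1) * (L ^ r * L ^ kk)) - 1)))) ≤ R₀ → oV * (1 + Fintype.card (Fin (d + 1) ⊕ Fin (d + 1))) + oN ≤ o →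
        -- the three two-grid fits of the PAIRING (displayed)
        (∀ k x' i, ∑ j, |(scChi' d L mv kk r hL k x' • tCoefC ((((L ^ r * L ^ kk : ℕ) : ℝ))⁻¹) (gaugePair (scShift' d L mv kk r hL) fun μ x' => coordMat e (ContinuousLinearMap.mulLeftRight ℝ (Matrix mm mm ℂ) (u' k x' * U' μ x' * (u' k (scShift' d L mv kk r hL μ x'))ᴴ) (u' k x' * U' μ x' * (u' k (scShift' d L mv kk r hL μ x'))ᴴ)ᴴ)) x') i j - (scChi d L mv kk hL k ((kingPr L kk r (cvM d L mv kk hL)) x') • tCoefC ((((L ^ kk : ℕ) : ℝ))⁻¹) (gaugePair (scShift d L mv kk hL) fun μ x => coordMat e (ContinuousLinearMap.mulLeftRight ℝ (Matrix mm mm ℂ) (u' k (kingSec (cvM d L mv kk hL) L kk r x) * U μ x * (u' k (kingSec (cvM d L mv kk hL) L kk r (scShift d L mv kk hL μ x)))ᴴ) (u' k (kingSec (cvM d L mv kk hL) L kk r x) * U μ x * (u' k (kingSec (cvM d L mv kk hL) L kk r (scShift d L mv kk hL μ x)))ᴴ)ᴴ)) ((kingPr L kk r (cvM d L mv kk hL))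 x')) i j| ≤ oV) →
        (∀ k j' x' i, ∑ j, |(scChi' d L mv kk r hL k x' • tCoefA ((((L ^ r * L ^ kk : ℕ) : ℝ))⁻¹) (gaugePair (scShift' d L mv kk r hL) fun μ x' => coordMat e (ContinuousLinearMap.mulLeftRight ℝ (Matrix mm mm ℂ) (u' k x' * U' μ x' * (u' k (scShift' d L mv kk r hL μ x'))ᴴ) (u' k x' * U' μ x' * (u' k (scShift' d L mv kk r hL μ x'))ᴴ)ᴴ)) j' x') i j - (scChi d L mv kk hL k ((kingPr L kk r (cvM d L mv kk hL)) x') • tCoefA ((((L ^ kk : ℕ) : ℝ))⁻¹) (gaugePair (scShift d L mv kk hL) fun μ x => coordMat e (ContinuousLinearMap.mulLeftRight ℝ (Matrix mm mm ℂ) (u' k (kingSec (cvM d L mv kk hL) L kk r x) * U μ x * (u' k (kingSec (cvM d L mv kk hL) L kk r (scShift d L mv kk hL μ x)))ᴴ) (u' k (kingSec (cvM d L mv kk hL) L kk r x) * U μ x * (u' k (kingSec (cvM d L mv kk hL) L kk r (scShift d L mv kk hL μ x)))ᴴ)ᴴ)) j' ((kingPr L kk r (cvM d L mv kk hL)) x'))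 i j| ≤ oV) →
        (∀ k, HasMaj (ScNorm d L mv kk hL ι) (BlockNorm.ofBlocks (unitTorusGeo L kk (cvM d L mv kk hL)) (liftBlk (scBlk d L mv kk hL ∘ kingPr L kk r (cvM d L mv kk hL)) ι)) (idef (pull (liftMap (kingPr L kk r (cvM d L mv kk hL)) ι)) (pull (liftMap (kingPr L kk r (cvM d L mv kk hL)) ι)) (mulOp (fun p : ScX' d L mv kk r hL × ι => scPsi' d L mv kk r hL k p.1) ∘ₗ (scNV' d L mv kk r hL (aK a₀ (L : ℝ) (r + kk) * (((L ^ r * L ^ kk : ℕ) : ℝ)) ^ (d + 1)) ι e u' U' k) ∘ₗ mulOp (fun p : ScX' d L mv kk r hL × ι => scChi' d L mv kk r hL k p.1)) (mulOp (fun p : ScX d L mv kk hL × ι => scPsi d L mv kk hL k p.1) ∘ₗ (scNV d L mv kk hL (aK a₀ (L : ℝ) kk * (((L ^ kk : ℕ) : ℝ)) ^ (d + 1)) ι e (fun k x => u' k (kingSec (cvM d L mv kk hL) L kk r x)) U k) ∘ₗ mulOp (fun p : ScX d L mv kk hL × ι => scChi d L mv kk hL k p.1))) (fun y y' => oN * Real.exp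 (-(δ * (unitTorusGeo L kk (cvM d L mv kk hL)).dist y y')))) →
        -- the PAIRING (displayed), and the all-direction step letter of the cube-gauged fine field on the plateau blocks
        (∀ μ y, U μ y = mprod (fun t => U' μ (kingSec (cvM d L mv kk hL) L kk r y + t • unitVec (fine (L ^ r * L ^ kk) (cvM d L mv kk hL)) μ)) (L ^ r)) →
      ∀ (b : ℝ), 0 ≤ b → (∀ k κ μ (z : ScX' d L mv kk r hL), scBlk' d L mv kk r hL z ∈ cvSk d L mv kk hL k → ‖u' k (z + unitVec (fine (L ^ r * L ^ kk) (cvM d L mv kk hL)) κ) * U' μ (z + unitVec (fine (L ^ r * L ^ kk) (cvM d L mv kk hL)) κ) * (u' k ((z + unitVec (fine (L ^ r * L ^ kk) (cvM d L mv kk hL)) κ) + unitVec (fine (L ^ r * L ^ kk) (cvM d L mv kk hL)) μ))ᴴ - (u' k z * U' μ z * (u' k (z + unitVec (fine (L ^ r * L ^ kk) (cvM d L mv kk hL)) μ))ᴴ)‖ ≤ b) →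
        HasMaj (ScNorm d L mv kk hL ι) (BlockNorm.ofBlocks (unitTorusGeo L kk (cvM d L mv kk hL)) (liftBlk (scBlk d L mv kk hL ∘ kingPr L kk r (cvM d L mv kk hL)) ι))
          (idef (ctauS (cvM d L mv kk hL) L kk r (fun μ x' => coordMat e (ContinuousLinearMap.mulLeftRight ℝ (Matrix mm mm ℂ) (U' μ x') (U' μ x')ᴴ))) (ctauS (cvM d L mv kk hL) L kk r (fun μ x' => coordMat e (ContinuousLinearMap.mulLeftRight ℝ (Matrix mm mm ℂ) (U' μ x') (U' μ x')ᴴ)))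
            (covLapM (scShift' d L mv kk r hL) ((((L ^ r * L ^ kk : ℕ) : ℝ))⁻¹) (gaugePair (scShift' d L mv kk r hL) (fun μ x => coordMat e (ContinuousLinearMap.mulLeftRight ℝ (Matrix mm mm ℂ) (U' μ x) (U' μ x)ᴴ))) ∘ₗ scGlued' d L mv kk r hL (aK a₀ (L : ℝ) (r + kk) * (((L ^ r * L ^ kk : ℕ) : ℝ)) ^ (d + 1)) ((((L ^ r * L ^ kk : ℕ) : ℝ))⁻¹) ι e u' U' (scP' d L mv kk r hL (aK a₀ (L : ℝ) (r + kk) * (((L ^ r * L ^ kk : ℕ) : ℝ)) ^ (d + 1)) ι e U') (scNV' d L mv kk r hL (aK a₀ (L : ℝ) (r + kk) * (((L ^ r * L ^ kk : ℕ) : ℝ)) ^ (d + 1)) ι e u' U'))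
            (covLapM (scShift d L mv kk hL) ((((L ^ kk : ℕ) : ℝ))⁻¹) (gaugePair (scShift d L mv kk hL) (fun μ x => coordMat e (ContinuousLinearMap.mulLeftRight ℝ (Matrix mm mm ℂ) (U μ x) (U μ x)ᴴ))) ∘ₗ scGlued d L mv kk hL (aK a₀ (L : ℝ) kk * (((L ^ kk : ℕ) : ℝ)) ^ (d + 1)) ((((L ^ kk : ℕ) : ℝ))⁻¹) ι e (fun k x => u' k (kingSec (cvM d L mv kk hL) L kk r x)) U (scP d L mv kk hL (aK a₀ (L : ℝ) kk * (((L ^ kk : ℕ) : ℝ)) ^ (d + 1)) ι e U) (scNV d L mv kk hL (aK a₀ (L : ℝ) kk * (((L ^ kk : ℕ) : ℝ)) ^ (d + 1)) ι e (fun k x => u' k (kingSec (cvM d L mv kk hL) L kk r x)) U)))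
          (fun y y' => ((a₀ * (Fintype.card ι : ℝ) ^ 2) * (D * (((L : ℝ) ^ kk) ^ (-(1 / 4 : ℝ)) + (o + ((1 + (Fintype.card ι * (((((L ^ r * L ^ kk : ℕ) : ℝ))⁻¹) * (@basisConst ι _ (Matrix mm mm ℂ) Matrix.frobeniusNormedAddCommGroup Matrix.frobeniusNormedSpace e * (2 * Real.sqrt (Fintype.card mm)) * (Real.sqrt (Fintype.card mm) * p))))) ^ ((d + 1) * (L ^ r - 1)) - 1)))) * c + ((Fintype.card (Fin (d + 1) → ZMod (2 * L)) : ℝ) * (((a₀ * (Fintype.card ι : ℝ) ^ 2) * (Fintype.card ι * (Real.pi * (d + 1) / (((L ^ kk : ℕ) : ℝ) * ((L ^ mv : ℕ) : ℝ))))) + ((Fintype.card ι : ℝ) ^ 2 * (((4 / 3 * a₀ * ((L : ℝ) ^ kk) ^ (-(2 : ℝ))) + (Fintype.card ι * (|aK a₀ (L : ℝ) (r + kk) - aK a₀ (L : ℝ) kk| * (1 + Fintype.card ι) + |aK a₀ (L : ℝ) kk| * (2 * Fintype.card ι * (@basisConst ι _ (Matrix mm mm ℂ) Matrix.frobeniusNormedAddCommGroup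 Matrix.frobeniusNormedSpace e * (2 * Real.sqrt (Fintype.card mm)) * (Real.sqrt (Fintype.card mm) * ((d + 1) * (d * ((((L ^ r * L ^ kk : ℕ) : ℝ)) * (((L ^ r : ℕ) : ℝ) * b)) + ((1 + (((((L ^ r * L ^ kk : ℕ) : ℝ))⁻¹) * p)) ^ (L ^ r) - 1)))))))) + ((a₀ * (Fintype.card ι : ℝ) ^ 2) * (Fintype.card ι * (Real.pi * (d + 1) / (((L ^ kk : ℕ) : ℝ) * ((L ^ mv : ℕ) : ℝ)))))) + ((1 + (Fintype.card ι * (@basisConst ι _ (Matrix mm mm ℂ) Matrix.frobeniusNormedAddCommGroup Matrix.frobeniusNormedSpace e * (2 * Real.sqrt (Fintype.card mm)) * (Real.sqrt (Fintype.card mm) * (((((L ^ r * L ^ kk : ℕ) : ℝ))⁻¹) * p))))) ^ ((d + 1) * (L ^ r - 1)) - 1) * (a₀ * (Fintype.card ι : ℝ) ^ 2) + ((1 + (Fintype.card ι * (@basisConst ι _ (Matrix mm mm ℂ) Matrix.frobeniusNormedAddCommGroup Matrix.frobeniusNormedSpace e * (2 * Real.sqrt (Fintype.card mm)) * (Real.sqrt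 (Fintype.card mm) * (((((L ^ r * L ^ kk : ℕ) : ℝ))⁻¹) * p))))) ^ ((d + 1) * (L ^ r - 1)) - 1) * (a₀ * (Fintype.card ι : ℝ) ^ 2))))) * B * c) * Real.exp (-(ρ₀ * (unitTorusGeo L kk (cvM d L mv kk hL)).dist y y'))) := by
  obtain ⟨δ, w₀, R₀, θ₀, D, B, c, ρ₀, hδ, hR₀, hθ₀, hρ₀, hD0, hB0, hc0, H⟩ := uN_idef_entryThree_tr (d := d) hL hL7 ha₀ ι
  have hL1r : (1 : ℝ) < (L : ℝ) := (by exact_mod_cast hL.2); have hL3 : 3 ≤ L := (by omega); have hLpos : 0 < L := (by omega)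
  refine ⟨δ, max w₀ 3, R₀, D, B, c, ρ₀, hδ, hR₀, hρ₀, hD0, hB0, hc0, fun mv kk r hk hr hw₀ => ?_⟩
  intro mm _ _ _ e he u' hu' U hU U' hU' Qf Qc p q hp hq hQf hQρ hQc hF1 hF2 hC1 hC2 rV oV oN o hrV hoV hoN hrA hrC hRle hole hfitC hfitA hDNV hpair b hb0 hbk
  have hw₀' : w₀ ≤ ((L ^ mv : ℕ) : ℝ) := (le_max_left _ _).trans hw₀
  have hW3 : 3 ≤ L ^ mv := by have h := (le_max_right w₀ 3).trans hw₀; exact_mod_cast h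
  have hW2 : 2 ≤ L ^ mv := (by omega); have hw : 0 < L ^ mv := (by omega)
  have hη : (0 : ℝ) < ((((L ^ kk : ℕ) : ℝ))⁻¹) := inv_pos.mpr (Nat.cast_pos.mpr (pow_pos hLpos kk))
  have hη' : (0 : ℝ) < ((((L ^ r * L ^ kk : ℕ) : ℝ))⁻¹) := inv_pos.mpr (Nat.cast_pos.mpr (Nat.mul_pos (pow_pos hLpos r) (pow_pos hLpos kk)))
  have hM : ∀ ν, cvM d L mv kk hL ν = 2 * L * L ^ mv := MP_succ_eq L mv kk hL
  have hm₁ : 2 * L ^ mv ≤ coverMargin L mv := two_mul_le_coverMargin hL7 mv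
  have hfitI : coverMargin L mv - 2 * L ^ mv + (6 * L ^ mv + 1) ≤ L * L ^ mv := coverMargin_inner_fit hL7 hW2
  have hS0 : L * L ^ mv ≤ 2 * L * L ^ mv := (by rw [mul_assoc]; omega)
  have hmg₂ : 2 * L ^ mv + 1 ≤ coverMargin L mv := (coverMargin_cut_margin hL7 hW3).1
  have hfg₂ : coverMargin L mv - 2 * L ^ mv + (6 * L ^ mv + 1) + 1 ≤ L * L ^ mv := (coverMargin_cut_margin hL7 hW3).2
  have hS6 : 6 * L ^ mv + 1 ≤ 2 * L * L ^ mv := by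
    have h7 : 7 * L ^ mv ≤ L * L ^ mv := Nat.mul_le_mul_right _ hL7
    have e7 : 2 * L * L ^ mv = 2 * (L * L ^ mv) := by ring
    rw [e7]; omega
  -- King's windows at both indices
  have haK : 0 < aK a₀ (L : ℝ) kk := aK_pos ha₀ hL1r hk
  have haKle : aK a₀ (L : ℝ) kk ≤ a₀ := aK_le ha₀ hL1r hk
  have ha' : 0 < (aK a₀ (L : ℝ) kk * (((L ^ kk : ℕ) : ℝ)) ^ (d + 1)) := by positivity
  have haK' : 0 < aK a₀ (L : ℝ) (r + kk) := aK_pos ha₀ hL1r (hk.trans (Nat.le_add_left kk r))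
  have haKle' : aK a₀ (L : ℝ) (r + kk) ≤ a₀ := aK_le ha₀ hL1r (hk.trans (Nat.le_add_left kk r))
  have ha'' : 0 < (aK a₀ (L : ℝ) (r + kk) * (((L ^ r * L ^ kk : ℕ) : ℝ)) ^ (d + 1)) := by positivity
  have habs : |(aK a₀ (L : ℝ) kk * (((L ^ kk : ℕ) : ℝ)) ^ (d + 1))| * ((((L ^ kk : ℕ) : ℝ)) ^ (d + 1))⁻¹ = aK a₀ (L : ℝ) kk := by rw [abs_of_pos ha', mul_assoc, mul_inv_cancel₀ (by positivity), mul_one]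
  have habs' : |(aK a₀ (L : ℝ) (r + kk) * (((L ^ r * L ^ kk : ℕ) : ℝ)) ^ (d + 1))| * ((((L ^ r * L ^ kk : ℕ) : ℝ)) ^ (d + 1))⁻¹ = aK a₀ (L : ℝ) (r + kk) := by rw [abs_of_pos ha'', mul_assoc, mul_inv_cancel₀ (by positivity), mul_one]
  -- the letters of the cut rows
  have hσc0 : 0 ≤ ((1 + rV * ((((L ^ kk : ℕ) : ℝ))⁻¹)) ^ ((d + 1) * L ^ kk) - 1) := by
    have := one_le_pow₀ (M₀ := ℝ) (a := 1 + rV * ((((L ^ kk : ℕ) : ℝ))⁻¹)) (by nlinarith [hη.le]) (n := (d + 1) * L ^ kk); linarith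
  have hσf0 : 0 ≤ ((1 + rV * ((((L ^ r * L ^ kk : ℕ) : ℝ))⁻¹)) ^ ((d + 1) * (L ^ r * L ^ kk)) - 1) := by
    have := one_le_pow₀ (M₀ := ℝ) (a := 1 + rV * ((((L ^ r * L ^ kk : ℕ) : ℝ))⁻¹)) (by nlinarith [hη'.le]) (n := (d + 1) * (L ^ r * L ^ kk)); linarith
  have hSc0 : 0 ≤ (Fintype.card ι * (Fintype.card ι * ((1 + rV * ((((L ^ kk : ℕ) : ℝ))⁻¹)) ^ ((d + 1) * L ^ kk) - 1) ^ 2 + 2 * ((1 + rV * ((((L ^ kk : ℕ) : ℝ))⁻¹)) ^ ((d + 1) * L ^ kk) - 1))) := (by positivity); have hSf0 : 0 ≤ (Fintype.card ι * (Fintype.card ι * ((1 + rV * ((((L ^ r * L ^ kk : ℕ) : ℝ))⁻¹)) ^ ((d + 1) * (L ^ r * L ^ kk)) - 1) ^ 2 + 2 * ((1 + rV * ((((L ^ r * L ^ kk : ℕ) : ℝ))⁻¹)) ^ ((d + 1) * (L ^ r * L ^ kk)) - 1))) := (by positivity)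
  have hRN0 : 0 ≤ a₀ * (Fintype.card ι * (Fintype.card ι * ((1 + rV * ((((L ^ kk : ℕ) : ℝ))⁻¹)) ^ ((d + 1) * L ^ kk) - 1) ^ 2 + 2 * ((1 + rV * ((((L ^ kk : ℕ) : ℝ))⁻¹)) ^ ((d + 1) * L ^ kk) - 1))) + a₀ * (Fintype.card ι * (Fintype.card ι * ((1 + rV * ((((L ^ r * L ^ kk : ℕ) : ℝ))⁻¹)) ^ ((d + 1) * (L ^ r * L ^ kk)) - 1) ^ 2 + 2 * ((1 + rV * ((((L ^ r * L ^ kk : ℕ) : ℝ))⁻¹)) ^ ((d + 1) * (L ^ r * L ^ kk)) - 1))) := by positivity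
  -- the induced coarse gauge, the transformed bond variables, unitarity ∕ orthogonality
  have hW : ∀ (k : Fin (d + 1) → ZMod (2 * L)) (x : ScX d L mv kk hL), ((fun k x => u' k (kingSec (cvM d L mv kk hL) L kk r x)) k x)ᴴ * (fun k x => u' k (kingSec (cvM d L mv kk hL) L kk r x)) k x = 1 := fun k x => hu' k _
  have hV'u : ∀ (k : Fin (d + 1) → ZMod (2 * L)) (μ : Fin (d + 1)) (z : ScX' d L mv kk r hL), (u' k z * U' μ z * (u' k (scShift' d L mv kk r hL μ z))ᴴ)ᴴ * (u' k z * U' μ z * (u' k (scShift' d L mv kk r hL μ z))ᴴ) = 1 := fun k μ z => uN_gaugeTransformed_bond_unitary (scShift' d L mv kk r hL) (u' k) U' (hu' k) hU' μ z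
  have hVu : ∀ (k : Fin (d + 1) → ZMod (2 * L)) (μ : Fin (d + 1)) (x : ScX d L mv kk hL), (u' k (kingSec (cvM d L mv kk hL) L kk r x) * U μ x * (u' k (kingSec (cvM d L mv kk hL) L kk r (scShift d L mv kk hL μ x)))ᴴ)ᴴ * (u' k (kingSec (cvM d L mv kk hL) L kk r x) * U μ x * (u' k (kingSec (cvM d L mv kk hL) L kk r (scShift d L mv kk hL μ x)))ᴴ) = 1 := fun k μ x => uN_gaugeTransformed_bond_unitary (scShift d L mv kk hL) ((fun k x => u' k (kingSec (cvM d L mv kk hL) L kk r x)) k) U (hW k) hU μ x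
  have hκ0 : 0 ≤ @basisConst ι _ (Matrix mm mm ℂ) Matrix.frobeniusNormedAddCommGroup Matrix.frobeniusNormedSpace e * (2 * Real.sqrt (Fintype.card mm)) := mul_nonneg (@basisConst_nonneg ι _ (Matrix mm mm ℂ) Matrix.frobeniusNormedAddCommGroup Matrix.frobeniusNormedSpace e) (by positivity)
  have hP10 : 0 ≤ (@basisConst ι _ (Matrix mm mm ℂ) Matrix.frobeniusNormedAddCommGroup Matrix.frobeniusNormedSpace e * (2 * Real.sqrt (Fintype.card mm)) * (Real.sqrt (Fintype.card mm) * p)) := by positivity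
  -- the entry letters (dag-n15-w2 §2), both grids
  have hE1' : ∀ (k : Fin (d + 1) → ZMod (2 * L)) (μ : Fin (d + 1)) (z : ScX' d L mv kk r hL), z ∈ Qf k → ∀ i j, |((fun μ x' => coordMat e (ContinuousLinearMap.mulLeftRight ℝ (Matrix mm mm ℂ) (u' k x' * U' μ x' * (u' k (scShift' d L mv kk r hL μ x'))ᴴ) (u' k x' * U' μ x' * (u' k (scShift' d L mv kk r hL μ x'))ᴴ)ᴴ)) μ z - 1) i j| ≤ ((((L ^ r * L ^ kk : ℕ) : ℝ))⁻¹) * (@basisConst ι _ (Matrix mm mm ℂ) Matrix.frobeniusNormedAddCommGroup Matrix.frobeniusNormedSpace e * (2 * Real.sqrt (Fintype.card mm)) * (Real.sqrt (Fintype.card mm) * p)) := fun k μ z hz i j => by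
    refine (uN_abs_coordMat_conj_sub_one_entry_le_op e (hV'u k μ z) i j).trans ?_
    calc @basisConst ι _ (Matrix mm mm ℂ) Matrix.frobeniusNormedAddCommGroup Matrix.frobeniusNormedSpace e * (2 * Real.sqrt (Fintype.card mm)) * (Real.sqrt (Fintype.card mm) * ‖(u' k z * U' μ z * (u' k (scShift' d L mv kk r hL μ z))ᴴ) - 1‖) ≤ @basisConst ι _ (Matrix mm mm ℂ) Matrix.frobeniusNormedAddCommGroup Matrix.frobeniusNormedSpace e * (2 * Real.sqrt (Fintype.card mm)) * (Real.sqrt (Fintype.card mm) * (((((L ^ r * L ^ kk : ℕ) : ℝ))⁻¹) * p)) := by gcongr; exact hF1 k μ z hz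
      _ = ((((L ^ r * L ^ kk : ℕ) : ℝ))⁻¹) * (@basisConst ι _ (Matrix mm mm ℂ) Matrix.frobeniusNormedAddCommGroup Matrix.frobeniusNormedSpace e * (2 * Real.sqrt (Fintype.card mm)) * (Real.sqrt (Fintype.card mm) * p)) := by ring
  have hE2' : ∀ (k : Fin (d + 1) → ZMod (2 * L)) (μ : Fin (d + 1)) (z : ScX' d L mv kk r hL), z ∈ Qf k → ∀ i j, |((fun μ x' => coordMat e (ContinuousLinearMap.mulLeftRight ℝ (Matrix mm mm ℂ) (u' k x' * U' μ x' * (u' k (scShift' d L mv kk r hL μ x'))ᴴ) (u' k x' * U' μ x' * (u' k (scShift' d L mv kk r hL μ x'))ᴴ)ᴴ)) μ z - (fun μ x' => coordMat e (ContinuousLinearMap.mulLeftRight ℝ (Matrix mm mm ℂ) (u' k x' * U' μ x' * (u' k (scShift' d L mv kk r hL μ x'))ᴴ) (u' k x' * U' μ x' * (u' k (scShift' d L mv kk r hL μ x'))ᴴ)ᴴ)) μ ((scShift' d L mv kk r hL μ).symm z)) i j| ≤ ((((L ^ r * L ^ kk : ℕ) : ℝ))⁻¹) ^ 2 * (@basisConst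 ι _ (Matrix mm mm ℂ) Matrix.frobeniusNormedAddCommGroup Matrix.frobeniusNormedSpace e * (2 * Real.sqrt (Fintype.card mm)) * (Real.sqrt (Fintype.card mm) * q)) := fun k μ z hz i j => by
    refine (uN_abs_coordMat_conj_sub_conj_entry_le_op e (hV'u k μ ((scShift' d L mv kk r hL μ).symm z)) (hV'u k μ z) i j).trans ?_
    calc @basisConst ι _ (Matrix mm mm ℂ) Matrix.frobeniusNormedAddCommGroup Matrix.frobeniusNormedSpace e * (2 * Real.sqrt (Fintype.card mm)) * (Real.sqrt (Fintype.card mm) * ‖(u' k z * U' μ z * (u' k (scShift' d L mv kk r hL μ z))ᴴ) - (u' k ((scShift' d L mv kk r hL μ).symm z) * U' μ ((scShift' d L mv kk r hL μ).symm z) * (u' k (scShift' d L mv kk r hL μ ((scShift' d L mv kk r hL μ).symm z)))ᴴ)‖) ≤ @basisConst ι _ (Matrix mm mm ℂ) Matrix.frobeniusNormedAddCommGroup Matrix.frobeniusNormedSpace e * (2 * Real.sqrt (Fintype.card mm)) * (Real.sqrt (Fintype.card mm) * (((((L ^ r * L ^ kk : ℕ) : ℝ))⁻¹) ^ 2 *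 q)) := by gcongr; exact hF2 k μ z hz
      _ = ((((L ^ r * L ^ kk : ℕ) : ℝ))⁻¹) ^ 2 * (@basisConst ι _ (Matrix mm mm ℂ) Matrix.frobeniusNormedAddCommGroup Matrix.frobeniusNormedSpace e * (2 * Real.sqrt (Fintype.card mm)) * (Real.sqrt (Fintype.card mm) * q)) := by ring
  have hE1 : ∀ (k : Fin (d + 1) → ZMod (2 * L)) (μ : Fin (d + 1)) (x : ScX d L mv kk hL), x ∈ Qc k → ∀ i j, |((fun μ x => coordMat e (ContinuousLinearMap.mulLeftRight ℝ (Matrix mm mm ℂ) (u' k (kingSec (cvM d L mv kk hL) L kk r x) * U μ x * (u' k (kingSec (cvM d L mv kk hL) L kk r (scShift d L mv kk hL μ x)))ᴴ) (u' k (kingSec (cvM d L mv kk hL) L kk r x) * U μ x * (u' k (kingSec (cvM d L mv kk hL) L kk r (scShift d L mv kk hL μ x)))ᴴ)ᴴ)) μ x - 1) i j| ≤ ((((L ^ kk : ℕ) : ℝ))⁻¹) * (@basisConst ι _ (Matrix mm mm ℂ) Matrix.frobeniusNormedAddCommGroup Matrix.frobeniusNormedSpace e * (2 * Real.sqrt (Fintype.card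 mm)) * (Real.sqrt (Fintype.card mm) * p)) := fun k μ x hx i j => by
    refine (uN_abs_coordMat_conj_sub_one_entry_le_op e (hVu k μ x) i j).trans ?_
    calc @basisConst ι _ (Matrix mm mm ℂ) Matrix.frobeniusNormedAddCommGroup Matrix.frobeniusNormedSpace e * (2 * Real.sqrt (Fintype.card mm)) * (Real.sqrt (Fintype.card mm) * ‖(u' k (kingSec (cvM d L mv kk hL) L kk r x) * U μ x * (u' k (kingSec (cvM d L mv kk hL) L kk r (scShift d L mv kk hL μ x)))ᴴ) - 1‖) ≤ @basisConst ι _ (Matrix mm mm ℂ) Matrix.frobeniusNormedAddCommGroup Matrix.frobeniusNormedSpace e * (2 * Real.sqrt (Fintype.card mm)) * (Real.sqrt (Fintype.card mm) * (((((L ^ kk : ℕ) : ℝ))⁻¹) * p)) := by gcongr; exact hC1 k μ x hx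
      _ = ((((L ^ kk : ℕ) : ℝ))⁻¹) * (@basisConst ι _ (Matrix mm mm ℂ) Matrix.frobeniusNormedAddCommGroup Matrix.frobeniusNormedSpace e * (2 * Real.sqrt (Fintype.card mm)) * (Real.sqrt (Fintype.card mm) * p)) := by ring
  have hE2 : ∀ (k : Fin (d + 1) → ZMod (2 * L)) (μ : Fin (d + 1)) (x : ScX d L mv kk hL), x ∈ Qc k → ∀ i j, |((fun μ x => coordMat e (ContinuousLinearMap.mulLeftRight ℝ (Matrix mm mm ℂ) (u' k (kingSec (cvM d L mv kk hL) L kk r x) * U μ x * (u' k (kingSec (cvM d L mv kk hL) L kk r (scShift d L mv kk hL μ x)))ᴴ) (u' k (kingSec (cvM d L mv kk hL) L kk r x) * U μ x * (u' k (kingSec (cvM d L mv kk hL) L kk r (scShift d L mv kk hL μ x)))ᴴ)ᴴ)) μ x - (fun μ x => coordMat e (ContinuousLinearMap.mulLeftRight ℝ (Matrix mm mm ℂ) (u' k (kingSec (cvM d L mv kk hL) L kk r x) * U μ x * (u' k (kingSec (cvM d L mv kk hL) L kk r (scShift d L mv kk hL μ x)))ᴴ) (u' k (kingSec (cvM d L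 mv kk hL) L kk r x) * U μ x * (u' k (kingSec (cvM d L mv kk hL) L kk r (scShift d L mv kk hL μ x)))ᴴ)ᴴ)) μ ((scShift d L mv kk hL μ).symm x)) i j| ≤ ((((L ^ kk : ℕ) : ℝ))⁻¹) ^ 2 * (@basisConst ι _ (Matrix mm mm ℂ) Matrix.frobeniusNormedAddCommGroup Matrix.frobeniusNormedSpace e * (2 * Real.sqrt (Fintype.card mm)) * (Real.sqrt (Fintype.card mm) * q)) := fun k μ x hx i j => by
    refine (uN_abs_coordMat_conj_sub_conj_entry_le_op e (hVu k μ ((scShift d L mv kk hL μ).symm x)) (hVu k μ x) i j).trans ?_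
    calc @basisConst ι _ (Matrix mm mm ℂ) Matrix.frobeniusNormedAddCommGroup Matrix.frobeniusNormedSpace e * (2 * Real.sqrt (Fintype.card mm)) * (Real.sqrt (Fintype.card mm) * ‖(u' k (kingSec (cvM d L mv kk hL) L kk r x) * U μ x * (u' k (kingSec (cvM d L mv kk hL) L kk r (scShift d L mv kk hL μ x)))ᴴ) - (u' k (kingSec (cvM d L mv kk hL) L kk r ((scShift d L mv kk hL μ).symm x)) * U μ ((scShift d L mv kk hL μ).symm x) * (u' k (kingSec (cvM d L mv kk hL) L kk r (scShift d L mv kk hL μ ((scShift d L mv kk hL μ).symm x))))ᴴ)‖) ≤ @basisConst ι _ (Matrix mm mm ℂ) Matrix.frobeniusNormedAddCommGroup Matrix.frobeniusNormedSpace e * (2 * Real.sqrt (Fintype.card mm)) * (Real.sqrt (Fintype.card mm) * (((((L ^ kk : ℕ) : ℝ))⁻¹) ^ 2 * q)) := by gcongr; exact hC2 k μ x hx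
      _ = ((((L ^ kk : ℕ) : ℝ))⁻¹) ^ 2 * (@basisConst ι _ (Matrix mm mm ℂ) Matrix.frobeniusNormedAddCommGroup Matrix.frobeniusNormedSpace e * (2 * Real.sqrt (Fintype.card mm)) * (Real.sqrt (Fintype.card mm) * q)) := by ring
  have hSo' : ∀ (k : Fin (d + 1) → ZMod (2 * L)) (μ : Fin (d + 1)) (z : ScX' d L mv kk r hL), (fun μ x' => coordMat e (ContinuousLinearMap.mulLeftRight ℝ (Matrix mm mm ℂ) (u' k x' * U' μ x' * (u' k (scShift' d L mv kk r hL μ x'))ᴴ) (u' k x' * U' μ x' * (u' k (scShift' d L mv kk r hL μ x'))ᴴ)ᴴ)) μ z * ((fun μ x' => coordMat e (ContinuousLinearMap.mulLeftRight ℝ (Matrix mm mm ℂ) (u' k x' * U' μ x' * (u' k (scShift' d L mv kk r hL μ x'))ᴴ) (u' k x' * U' μ x' * (u' k (scShift' d L mv kk r hL μ x'))ᴴ)ᴴ)) μ z)ᵀ = 1 := fun k μ z => (uN_coordMat_conj_orthogonal e he (hV'u k μ z)).2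
  have hSo : ∀ (k : Fin (d + 1) → ZMod (2 * L)) (μ : Fin (d + 1)) (x : ScX d L mv kk hL), (fun μ x => coordMat e (ContinuousLinearMap.mulLeftRight ℝ (Matrix mm mm ℂ) (u' k (kingSec (cvM d L mv kk hL) L kk r x) * U μ x * (u' k (kingSec (cvM d L mv kk hL) L kk r (scShift d L mv kk hL μ x)))ᴴ) (u' k (kingSec (cvM d L mv kk hL) L kk r x) * U μ x * (u' k (kingSec (cvM d L mv kk hL) L kk r (scShift d L mv kk hL μ x)))ᴴ)ᴴ)) μ x * ((fun μ x => coordMat e (ContinuousLinearMap.mulLeftRight ℝ (Matrix mm mm ℂ) (u' k (kingSec (cvM d L mv kk hL) L kk r x) * U μ x * (u' k (kingSec (cvM d L mv kk hL) L kk r (scShift d L mv kk hL μ x)))ᴴ) (u' k (kingSec (cvM d L mv kk hL) L kk r x) * U μ x * (u' k (kingSec (cvM d L mv kk hL) L kk r (scShift d L mv kk hL μ x)))ᴴ)ᴴ)) μ x)ᵀ = 1 := fun k μ x => (uN_coordMat_conj_orthogonal e he (hVu k μ x)).2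
  -- 339's coefficient letters `hCloc hAloc hCloc′ hAloc′` (dag-n15-w2 §1, pointwise)
  have hAloc' : ∀ k j' x', scChi' d L mv kk r hL k x' ≠ 0 → ∀ i, ∑ j, |tCoefA ((((L ^ r * L ^ kk : ℕ) : ℝ))⁻¹) (gaugePair (scShift' d L mv kk r hL) (fun μ x' => coordMat e (ContinuousLinearMap.mulLeftRight ℝ (Matrix mm mm ℂ) (u' k x' * U' μ x' * (u' k (scShift' d L mv kk r hL μ x'))ᴴ) (u' k x' * U' μ x' * (u' k (scShift' d L mv kk r hL μ x'))ᴴ)ᴴ))) j' x' i j| ≤ rV := fun k j' x' hx' i => by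
    obtain ⟨h0, h2⟩ := hQf k x' hx'
    cases j' with
    | inl μ => exact (rowSum_tCoefA_inl_le_at ((((L ^ r * L ^ kk : ℕ) : ℝ))⁻¹) (scShift' d L mv kk r hL) _ hη' (hE1' k μ x' h0) i).trans hrA
    | inr μ => exact (rowSum_tCoefA_inr_le_at ((((L ^ r * L ^ kk : ℕ) : ℝ))⁻¹) (scShift' d L mv kk r hL) _ hη' (hE1' k μ _ (h2 μ)) i).trans hrA
  have hCloc' : ∀ k x', scChi' d L mv kk r hL k x' ≠ 0 → ∀ i, ∑ j, |tCoefC ((((L ^ r * L ^ kk : ℕ) : ℝ))⁻¹) (gaugePair (scShift' d L mv kk r hL) (fun μ x' => coordMat e (ContinuousLinearMap.mulLeftRight ℝ (Matrix mm mm ℂ) (u' k x' * U' μ x' * (u' k (scShift' d L mv kk r hL μ x'))ᴴ) (u' k x' * U' μ x' * (u' k (scShift' d L mv kk r hL μ x'))ᴴ)ᴴ))) x' i j| ≤ rV := fun k x' hx' i =>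
    (rowSum_tCoefC_le_at ((((L ^ r * L ^ kk : ℕ) : ℝ))⁻¹) (scShift' d L mv kk r hL) _ hη' hP10 (hSo' k) (fun μ => hE1' k μ x' (hQf k x' hx').1) (fun μ => hE2' k μ x' (hQf k x' hx').1) i).trans hrC
  have hAloc : ∀ k j' x, scChi d L mv kk hL k x ≠ 0 → ∀ i, ∑ j, |tCoefA ((((L ^ kk : ℕ) : ℝ))⁻¹) (gaugePair (scShift d L mv kk hL) (fun μ x => coordMat e (ContinuousLinearMap.mulLeftRight ℝ (Matrix mm mm ℂ) (u' k (kingSec (cvM d L mv kk hL) L kk r x) * U μ x * (u' k (kingSec (cvM d L mv kk hL) L kk r (scShift d L mv kk hL μ x)))ᴴ) (u' k (kingSec (cvM d L mv kk hL) L kk r x) * U μ x * (u' k (kingSec (cvM d L mv kk hL) L kk r (scShift d L mv kk hL μ x)))ᴴ)ᴴ))) j' x i j| ≤ rV := fun k j' x hx i => by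
    obtain ⟨h0, h2⟩ := hQc k x hx
    cases j' with
    | inl μ => exact (rowSum_tCoefA_inl_le_at ((((L ^ kk : ℕ) : ℝ))⁻¹) (scShift d L mv kk hL) _ hη (hE1 k μ x h0) i).trans hrA
    | inr μ => exact (rowSum_tCoefA_inr_le_at ((((L ^ kk : ℕ) : ℝ))⁻¹) (scShift d L mv kk hL) _ hη (hE1 k μ _ (h2 μ)) i).trans hrA
  have hCloc : ∀ k x, scChi d L mv kk hL k x ≠ 0 → ∀ i, ∑ j, |tCoefC ((((L ^ kk : ℕ) : ℝ))⁻¹) (gaugePair (scShift d L mv kk hL) (fun μ x => coordMat e (ContinuousLinearMap.mulLeftRight ℝ (Matrix mm mm ℂ) (u' k (kingSec (cvM d L mv kk hL) L kk r x) * U μ x * (u' k (kingSec (cvM d L mv kk hL) L kk r (scShift d L mv kk hL μ x)))ᴴ) (u' k (kingSec (cvM d L mv kk hL) L kk r x) * U μ x * (u' k (kingSec (cvM d L mv kk hL) L kk r (scShift d L mv kk hL μ x)))ᴴ)ᴴ))) x i j| ≤ rV := fun k x hx i =>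
    (rowSum_tCoefC_le_at ((((L ^ kk : ℕ) : ℝ))⁻¹) (scShift d L mv kk hL) _ hη hP10 (hSo k) (fun μ => hE1 k μ x (hQc k x hx).1) (fun μ => hE2 k μ x (hQc k x hx).1) i).trans hrC
  -- the column letter of `Ad V′` on the plateau cube
  have hρ : ∀ (k : Fin (d + 1) → ZMod (2 * L)) (μ : Fin (d + 1)) (y' : ScX' d L mv kk r hL), scBlk' d L mv kk r hL y' ∈ cvSk d L mv kk hL k → ∀ j, ∑ i, |(coordMat e (ContinuousLinearMap.mulLeftRight ℝ (Matrix mm mm ℂ)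
      (u' k y' * U' μ y' * (u' k (y' + unitVec (fine (L ^ r * L ^ kk) (cvM d L mv kk hL)) μ))ᴴ) (u' k y' * U' μ y' * (u' k (y' + unitVec (fine (L ^ r * L ^ kk) (cvM d L mv kk hL)) μ))ᴴ)ᴴ) - 1) i j| ≤ (Fintype.card ι * (((((L ^ r * L ^ kk : ℕ) : ℝ))⁻¹) * (@basisConst ι _ (Matrix mm mm ℂ) Matrix.frobeniusNormedAddCommGroup Matrix.frobeniusNormedSpace e * (2 * Real.sqrt (Fintype.card mm)) * (Real.sqrt (Fintype.card mm) * p)))) := fun k μ y' hy' j =>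
    calc _ ≤ ∑ _i : ι, ((((L ^ r * L ^ kk : ℕ) : ℝ))⁻¹) * (@basisConst ι _ (Matrix mm mm ℂ) Matrix.frobeniusNormedAddCommGroup Matrix.frobeniusNormedSpace e * (2 * Real.sqrt (Fintype.card mm)) * (Real.sqrt (Fintype.card mm) * p)) := Finset.sum_le_sum fun i _ => hE1' k μ y' (hQρ k y' hy') i j
      _ = (Fintype.card ι * (((((L ^ r * L ^ kk : ℕ) : ℝ))⁻¹) * (@basisConst ι _ (Matrix mm mm ℂ) Matrix.frobeniusNormedAddCommGroup Matrix.frobeniusNormedSpace e * (2 * Real.sqrt (Fintype.card mm)) * (Real.sqrt (Fintype.card mm) * p)))) := by rw [Finset.sum_const, Finset.card_univ, nsmul_eq_mul]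
  -- the partition sits in the cut box (for `hPloc`)
  have hhχ : ∀ (k : Fin (d + 1) → ZMod (2 * L)) (x : ScX d L mv kk hL), scH d L mv kk hL k x ≠ 0 → scChi d L mv kk hL k x ≠ 0 := fun k x hx => by
    have h := chiCube_box_eq_one_of_coverH_ne_zero (n := L ^ kk) hM hw hS6 0 k (x := (x, (0 : Fin (d + 1)))) (Or.inl rfl) hx
    rw [show scChi d L mv kk hL k x = chiCube (cvM d L mv kk hL) (L ^ kk) (coverCorner (cvM d L mv kk hL) (L ^ mv) L (2 * L ^ mv) k) (6 * L ^ mv + 1) (x, 0) from rfl, h]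
    exact one_ne_zero
  -- (E3) the two displayed rows of the summand for n15-c∕380: n15-c∕377 on the target blocks, n15-c∕379 at `ρ = η′p`
  have hL2R : (2 : ℝ) ≤ (L : ℝ) := by exact_mod_cast (show 2 ≤ L by omega)
  have hlift : liftBlk (scBlk' d L mv kk r hL) ι = liftBlk (scBlk d L mv kk hL ∘ kingPr L kk r (cvM d L mv kk hL)) ι := funext fun p => (blockOf_kingPr (cvM d L mv kk hL) L kk r p.1).symm
  have hProw : HasMaj (BlockNorm.ofBlocks (unitTorusGeo L kk (cvM d L mv kk hL)) (liftBlk (scBlk d L mv kk hL ∘ kingPr L kk r (cvM d L mv kk hL)) ι)) (BlockNorm.ofBlocks (unitTorusGeo L kk (cvM d L mv kk hL)) (liftBlk (scBlk d L mv kk hL ∘ kingPr L kk r (cvM d L mv kk hL)) ι)) (scP' d L mv kk r hL (aK a₀ (L : ℝ) (r + kk) * (((L ^ r * L ^ kk : ℕ) : ℝ)) ^ (d + 1)) ι e U') (fun y y' => (a₀ * (Fintype.card ι : ℝ) ^ 2) * Real.exp (-(δ * (unitTorusGeo L kk (cvM d L mv kk hL)).dist y y'))) := by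
    have h := hasMaj_scP'_of_unitary (d := d) ι e he hU' (aK a₀ (L : ℝ) (r + kk) * (((L ^ r * L ^ kk : ℕ) : ℝ)) ^ (d + 1)) δ
    rw [show ScNorm' d L mv kk r hL ι = (BlockNorm.ofBlocks (unitTorusGeo L kk (cvM d L mv kk hL)) (liftBlk (scBlk d L mv kk hL ∘ kingPr L kk r (cvM d L mv kk hL)) ι)) from congrArg (BlockNorm.ofBlocks (unitTorusGeo L kk (cvM d L mv kk hL))) hlift] at h
    refine h.mono fun y y' => ?_
    rw [habs']
    have : aK a₀ (L : ℝ) (r + kk) * (Fintype.card ι : ℝ) ^ 2 ≤ a₀ * (Fintype.card ι : ℝ) ^ 2 := by gcongr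
    exact mul_le_mul_of_nonneg_right this (Real.exp_nonneg _)
  have hχh : ∀ k : (Fin (d + 1) → ZMod (2 * L)), mulOp (fun p : ScX d L mv kk hL × ι => scChi d L mv kk hL k p.1) ∘ₗ mulOp (fun p : ScX d L mv kk hL × ι => scH d L mv kk hL k p.1) = mulOp (fun p : ScX d L mv kk hL × ι => scH d L mv kk hL k p.1) := fun k =>
    mulOp_comp_mulOp_of_support_left fun p hp => chiCube_box_eq_one_of_coverH_ne_zero (n := L ^ kk) hM hw hS6 0 k (x := (p.1, (0 : Fin (d + 1)))) (Or.inl rfl) hp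
  have hχhf : ∀ k : (Fin (d + 1) → ZMod (2 * L)), mulOp (fun p : ScX' d L mv kk r hL × ι => scChi' d L mv kk r hL k p.1) ∘ₗ mulOp (fun p : ScX' d L mv kk r hL × ι => scH' d L mv kk r hL k p.1) = mulOp (fun p : ScX' d L mv kk r hL × ι => scH' d L mv kk r hL k p.1) := fun k =>
    mulOp_comp_mulOp_of_support_left fun p hp => chiCube_box_eq_one_of_coverH_ne_zero (n := L ^ r * L ^ kk) hM hw hS6 0 k (x := (p.1, (0 : Fin (d + 1)))) (Or.inl rfl) hp
  have hsA : (0 : ℝ) ≤ ((1 + (Fintype.card ι * (@basisConst ι _ (Matrix mm mm ℂ) Matrix.frobeniusNormedAddCommGroup Matrix.frobeniusNormedSpace e * (2 * Real.sqrt (Fintype.card mm)) * (Real.sqrt (Fintype.card mm) * (((((L ^ r * L ^ kk : ℕ) : ℝ))⁻¹) * p))))) ^ ((d + 1) * (L ^ r - 1)) - 1) := by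
    have := one_le_pow₀ (M₀ := ℝ) (a := 1 + (Fintype.card ι * (@basisConst ι _ (Matrix mm mm ℂ) Matrix.frobeniusNormedAddCommGroup Matrix.frobeniusNormedSpace e * (2 * Real.sqrt (Fintype.card mm)) * (Real.sqrt (Fintype.card mm) * (((((L ^ r * L ^ kk : ℕ) : ℝ))⁻¹) * p))))) (le_add_of_nonneg_right (by positivity)) (n := (d + 1) * (L ^ r - 1)); linarith
  have hsB : (0 : ℝ) ≤ ((1 + (((((L ^ r * L ^ kk : ℕ) : ℝ))⁻¹) * p)) ^ (L ^ r) - 1) := by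
    have := one_le_pow₀ (M₀ := ℝ) (a := 1 + (((((L ^ r * L ^ kk : ℕ) : ℝ))⁻¹) * p)) (le_add_of_nonneg_right (by positivity)) (n := L ^ r); linarith
  have hOP0 : (0 : ℝ) ≤ ((Fintype.card (Fin (d + 1) → ZMod (2 * L)) : ℝ) * (((a₀ * (Fintype.card ι : ℝ) ^ 2) * (Fintype.card ι * (Real.pi * (d + 1) / (((L ^ kk : ℕ) : ℝ) * ((L ^ mv : ℕ) : ℝ))))) + ((Fintype.card ι : ℝ) ^ 2 * (((4 / 3 * a₀ * ((L : ℝ) ^ kk) ^ (-(2 : ℝ))) + (Fintype.card ι * (|aK a₀ (L : ℝ) (r + kk) - aK a₀ (L : ℝ) kk| * (1 + Fintype.card ι) + |aK a₀ (L : ℝ) kk| * (2 * Fintype.card ι * (@basisConst ι _ (Matrix mm mm ℂ) Matrix.frobeniusNormedAddCommGroup Matrix.frobeniusNormedSpace e * (2 * Real.sqrt (Fintype.card mm)) * (Real.sqrt (Fintype.card mm) * ((d + 1) * (d * ((((L ^ r * L ^ kk : ℕ) : ℝ)) * (((L ^ r : ℕ) : ℝ) * b)) + ((1 + (((((L ^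 r * L ^ kk : ℕ) : ℝ))⁻¹) * p)) ^ (L ^ r) - 1)))))))) + ((a₀ * (Fintype.card ι : ℝ) ^ 2) * (Fintype.card ι * (Real.pi * (d + 1) / (((L ^ kk : ℕ) : ℝ) * ((L ^ mv : ℕ) : ℝ)))))) + ((1 + (Fintype.card ι * (@basisConst ι _ (Matrix mm mm ℂ) Matrix.frobeniusNormedAddCommGroup Matrix.frobeniusNormedSpace e * (2 * Real.sqrt (Fintype.card mm)) * (Real.sqrt (Fintype.card mm) * (((((L ^ r * L ^ kk : ℕ) : ℝ))⁻¹) * p))))) ^ ((d + 1) * (L ^ r - 1)) - 1) * (a₀ * (Fintype.card ι : ℝ) ^ 2) + ((1 + (Fintype.card ι * (@basisConst ι _ (Matrix mm mm ℂ) Matrix.frobeniusNormedAddCommGroup Matrix.frobeniusNormedSpace e * (2 * Real.sqrt (Fintype.card mm)) * (Real.sqrt (Fintype.card mm) * (((((L ^ r * L ^ kk : ℕ) : ℝ))⁻¹) * p))))) ^ ((d + 1) * (L ^ r - 1)) - 1) * (a₀ * (Fintype.card ι : ℝ) ^ 2))))) := by positivity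
  have hDProw := hasMaj_idef_ctauS_scP ι e hM hm₁ hfitI hS0 hw hL2R hk he ha₀ u' hu' U' hU' U hpair (ρ := (((((L ^ r * L ^ kk : ℕ) : ℝ))⁻¹) * p)) (b := b) (by positivity) hb0
    (fun k μ z hz => hF1 k μ z (hQρ k z hz)) hbk hδ.le hχh hχhf
  -- n15-c∕380
  have key := H mv kk r hk hr hw₀' e he u' hu' U U' hU' (scP d L mv kk hL (aK a₀ (L : ℝ) kk * (((L ^ kk : ℕ) : ℝ)) ^ (d + 1)) ι e U) (scP' d L mv kk r hL (aK a₀ (L : ℝ) (r + kk) * (((L ^ r * L ^ kk : ℕ) : ℝ)) ^ (d + 1)) ι e U') (scNV d L mv kk hL (aK a₀ (L : ℝ) kk * (((L ^ kk : ℕ) : ℝ)) ^ (d + 1)) ι e (fun k x => u' k (kingSec (cvM d L mv kk hL) L kk r x)) U) (scNV' d L mv kk r hL (aK a₀ (L : ℝ) (r + kk) * (((L ^ r * L ^ kk : ℕ) : ℝ)) ^ (d + 1)) ι e u' U')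
    rV (a₀ * (Fintype.card ι * (Fintype.card ι * ((1 + rV * ((((L ^ kk : ℕ) : ℝ))⁻¹)) ^ ((d + 1) * L ^ kk) - 1) ^ 2 + 2 * ((1 + rV * ((((L ^ kk : ℕ) : ℝ))⁻¹)) ^ ((d + 1) * L ^ kk) - 1))) + a₀ * (Fintype.card ι * (Fintype.card ι * ((1 + rV * ((((L ^ r * L ^ kk : ℕ) : ℝ))⁻¹)) ^ ((d + 1) * (L ^ r * L ^ kk)) - 1) ^ 2 + 2 * ((1 + rV * ((((L ^ r * L ^ kk : ℕ) : ℝ))⁻¹)) ^ ((d + 1) * (L ^ r * L ^ kk)) - 1)))) 0 0 oV oN o (Fintype.card ι * (((((L ^ r * L ^ kk : ℕ) : ℝ))⁻¹) * (@basisConst ι _ (Matrix mm mm ℂ) Matrix.frobeniusNormedAddCommGroup Matrix.frobeniusNormedSpace e * (2 * Real.sqrt (Fintype.card mm)) * (Real.sqrt (Fintype.card mm) * p)))) hrV hRN0 le_rfl hoV hoN (by positivity) le_rfl hRle hole hθ₀.le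
    (fun k => scP_conj ι e (aK a₀ (L : ℝ) kk * (((L ^ kk : ℕ) : ℝ)) ^ (d + 1)) (fun k x => u' k (kingSec (cvM d L mv kk hL) L kk r x)) U k) (fun k => scP'_conj ι e (aK a₀ (L : ℝ) (r + kk) * (((L ^ r * L ^ kk : ℕ) : ℝ)) ^ (d + 1)) u' U' k) hCloc hAloc hCloc' hAloc' hfitC hfitA
    (fun k => (hasMaj_scNV_cut_of_rows ι e he (aK a₀ (L : ℝ) kk * (((L ^ kk : ℕ) : ℝ)) ^ (d + 1)) hW U hrV k (fun μ x hx i => hAloc k (Sum.inl μ) x hx i) δ).mono fun y y' =>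
      mul_le_mul_of_nonneg_right (by rw [habs]; nlinarith [mul_le_mul_of_nonneg_right haKle hSc0, mul_nonneg ha₀.le hSf0]) (Real.exp_nonneg _))
    (fun k => (hasMaj_scNV'_cut_of_rows ι e he (aK a₀ (L : ℝ) (r + kk) * (((L ^ r * L ^ kk : ℕ) : ℝ)) ^ (d + 1)) hu' U' hrV k (fun μ x hx i => hAloc' k (Sum.inl μ) x hx i) δ).mono fun y y' =>
      mul_le_mul_of_nonneg_right (by rw [habs']; nlinarith [mul_le_mul_of_nonneg_right haKle' hSf0, mul_nonneg ha₀.le hSc0]) (Real.exp_nonneg _))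
    hDNV
    (fun k => by
      rw [one_sub_scPsi_comp_scNV_comp_scChi ι e he hM hm₁ hfitI hS0 (aK a₀ (L : ℝ) kk * (((L ^ kk : ℕ) : ℝ)) ^ (d + 1)) hW U k]
      exact (hasMaj_zero _ _).mono fun y y' => by positivity)
    (fun k => by
      rw [one_sub_scPsi'_comp_scNV'_comp_scChi' ι e he hM hm₁ hfitI hS0 (aK a₀ (L : ℝ) (r + kk) * (((L ^ r * L ^ kk : ℕ) : ℝ)) ^ (d + 1)) hu' U' k]
      exact (hasMaj_zero _ _).mono fun y y' => by positivity)
    (fun k => by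
      rw [one_sub_scPsi_comp_scNV_comp_scChi ι e he hM hm₁ hfitI hS0 (aK a₀ (L : ℝ) kk * (((L ^ kk : ℕ) : ℝ)) ^ (d + 1)) hW U k, one_sub_scPsi'_comp_scNV'_comp_scChi' ι e he hM hm₁ hfitI hS0 (aK a₀ (L : ℝ) (r + kk) * (((L ^ r * L ^ kk : ℕ) : ℝ)) ^ (d + 1)) hu' U' k, idef_zero]
      exact (hasMaj_zero _ _).mono fun y y' => by positivity)
    hρ (fun k => mulOp_one_sub_scPsi_comp_csavgGram_comp_mulOp_scH ι hM hmg₂ hfg₂ hS0 (cvT e U) (aK a₀ (L : ℝ) kk * (((L ^ kk : ℕ) : ℝ)) ^ (d + 1)) k (hhχ k))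
    (a₀ * (Fintype.card ι : ℝ) ^ 2) ((Fintype.card (Fin (d + 1) → ZMod (2 * L)) : ℝ) * (((a₀ * (Fintype.card ι : ℝ) ^ 2) * (Fintype.card ι * (Real.pi * (d + 1) / (((L ^ kk : ℕ) : ℝ) * ((L ^ mv : ℕ) : ℝ))))) + ((Fintype.card ι : ℝ) ^ 2 * (((4 / 3 * a₀ * ((L : ℝ) ^ kk) ^ (-(2 : ℝ))) + (Fintype.card ι * (|aK a₀ (L : ℝ) (r + kk) - aK a₀ (L : ℝ) kk| * (1 + Fintype.card ι) + |aK a₀ (L : ℝ) kk| * (2 * Fintype.card ι * (@basisConst ι _ (Matrix mm mm ℂ) Matrix.frobeniusNormedAddCommGroup Matrix.frobeniusNormedSpace e * (2 * Real.sqrt (Fintype.card mm)) * (Real.sqrt (Fintype.card mm) * ((d + 1) * (d * ((((L ^ r * L ^ kk : ℕ) : ℝ)) * (((L ^ r : ℕ) : ℝ) * b)) + ((1 + (((((L ^ r * L ^ kk : ℕ) : ℝ))⁻¹) * p)) ^ (L ^ r) - 1)))))))) + ((a₀ * (Fintype.card ι : ℝ) ^ 2) * (Fintype.card ι * (Real.pi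 * (d + 1) / (((L ^ kk : ℕ) : ℝ) * ((L ^ mv : ℕ) : ℝ)))))) + ((1 + (Fintype.card ι * (@basisConst ι _ (Matrix mm mm ℂ) Matrix.frobeniusNormedAddCommGroup Matrix.frobeniusNormedSpace e * (2 * Real.sqrt (Fintype.card mm)) * (Real.sqrt (Fintype.card mm) * (((((L ^ r * L ^ kk : ℕ) : ℝ))⁻¹) * p))))) ^ ((d + 1) * (L ^ r - 1)) - 1) * (a₀ * (Fintype.card ι : ℝ) ^ 2) + ((1 + (Fintype.card ι * (@basisConst ι _ (Matrix mm mm ℂ) Matrix.frobeniusNormedAddCommGroup Matrix.frobeniusNormedSpace e * (2 * Real.sqrt (Fintype.card mm)) * (Real.sqrt (Fintype.card mm) * (((((L ^ r * L ^ kk : ℕ) : ℝ))⁻¹) * p))))) ^ ((d + 1) * (L ^ r - 1)) - 1) * (a₀ * (Fintype.card ι : ℝ) ^ 2))))) (by positivity) hOP0 hProw hDProw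
  exact key.mono fun y y' => le_of_eq (by rw [add_zero])

end Green

end Summit.QuantumFields.YangMills.BalabanUVNodes.N15.Gluing

end
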